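import Literature.Barriers.AtomisticToContinuum.NoBVEstimatesMultiDFinitePropagationOneD
import HarnessLib

/-!
# Finite speed of propagation for Rauch's class: systems with two unknowns (`k = 2`)

The named fact `Rauch1986_finitePropagationSpeed` [Rauch1986, Proof of Theorem p. 482: "Using
the finite speed of propagation for (1)"] is proved in the tree for the symmetrizable branch of
Rauch's class (`Rauch1986_finitePropagationSpeed_symmetrizable_holds`), for `k ≤ 1`
(`exists_hasPropagationSpeed_of_isRauchClass_of_le_one`) and for `d ≤ 1`
(`NoBVEstimatesMultiDFinitePropagationOneD.lean`), leaving the strictly hyperbolic branch with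
`d ≥ 2`, `k ≥ 2` (`Rauch1986_finitePropagationSpeed_of_two_le`). This file settles `k = 2` in
every space dimension by elementary `2 × 2` algebra, so that what remains is `d ≥ 2`, `k ≥ 3`
(`Rauch1986_finitePropagationSpeed_of_three_le`):

* A real `2 × 2` matrix `P` has two distinct real eigenvalues iff its discriminant
  `disc₂ P = (P₀₀ - P₁₁)² + 4P₀₁P₁₀ = (tr P)² - 4 det P` is positive
  (`disc₂_pos_of_charpoly_eq_prod`); along a pencil, `disc₂ (xP + yQ)` is the binary quadratic
  form `disc₂ P · x² + 2 discPolar₂ P Q · xy + disc₂ Q · y²` (`disc₂_add_smul`). Rauch's strict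
  hyperbolicity at `u` (with `det A₀(u) ≠ 0`) makes `disc₂ (adj A₀ Σ ξⱼAⱼ) > 0` for `ξ ≠ 0`
  (`IsStrictlyHyperbolicAt.disc₂_pos`, from `IsStrictlyHyperbolicAt.charpoly_adjugate_mul_eq_prod`).
* `d = 2`: **a strictly hyperbolic pair is simultaneously symmetrizable.** For `P, Q` with
  `a = P₀₀ - P₁₁, b = P₀₁, c = P₁₀` (primes for `Q`), `S P` is symmetric for the symmetric
  matrix `S = [[p, r], [r, s]]` iff `pb - ra - sc = 0`; the cross product
  `(p, r, s) = (b, -a, -c) × (b', -a', -c')` solves both conditions (`pairSymmetrizer₂`,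
  `isSymm_pairSymmetrizer₂_mul_left/right`), and `4 det S = disc₂ P · disc₂ Q - (discPolar₂ P Q)²`
  (`four_mul_det_pairSymmetrizer₂`) is the discriminant of the binary form, positive when the
  form is positive definite (`det_pairSymmetrizer₂_pos`); a symmetric `2 × 2` matrix with
  `det > 0` is definite (`posDef_fin_two_of_det_pos`). Hence
  `Sym(u) = ± det A₀(u) · S(adj A₀ A₁, adj A₀ A₂)(u) · adj A₀(u)` (`tripleSymmetrizer₂`, a
  polynomial in the entries, smooth by functoriality over the algebra of smooth functions,
  `contDiff_tripleSymmetrizer₂_apply`; the sign is fixed at `ū` and kept on a neighbourhood by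
  continuity) has `Sym A₀ = ± det(A₀)² S` symmetric positive definite and `Sym A₁`, `Sym A₂`
  symmetric: `IsStrictlyHyperbolicNear.isSymmetrizableNear_two_two`. (That `2 × 2` strictly
  hyperbolic systems in two space variables are symmetrizable is classical; the tree records the
  general discussion of symmetrizers in [Taylor1981, Ch. IV §3].)
* `d ≥ 3`: **vacuous** — no `2 × 2` system in three or more space variables is strictly
  hyperbolic with `A₀` invertible at any state (`not_isStrictlyHyperbolicAt_of_three_le`): the
  two linear conditions "`Σ ξⱼ(Pⱼ)₀₀ = Σ ξⱼ(Pⱼ)₁₁`" and "`Σ ξⱼ(Pⱼ)₀₁ = -Σ ξⱼ(Pⱼ)₁₀`" on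
  `ξ ∈ ℝᵈ`, `d ≥ 3`, have a common solution `ξ ≠ 0` (rank–nullity), at which
  `disc₂ = -4b² ≤ 0` (the discriminant is a quadratic form of signature `(2, 1)` on `sl₂(ℝ)`).
* Consequences: `hasPropagationSpeed_of_isStrictlyHyperbolicNear_of_k_eq_two`,
  `exists_hasPropagationSpeed_of_isRauchClass_of_le_two` (Rauch's fact unconditionally for
  `k ≤ 2`), and the reduction `Rauch1986_finitePropagationSpeed_of_three_le`: the named fact
  rests only on the strictly hyperbolic case with `d ≥ 2`, `k ≥ 3` — genuine systems in several
  space variables, where a strictly hyperbolic system need not admit a matrix symmetrizer and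
  the printed proofs use symbolic symmetrizers [Taylor1981, Ch. IV §3 Prop. 3.1, §4 Thm 4.5].

## References

* [Rauch1986] J. Rauch, Comm. Math. Phys. 106 (1986) 481–484: p. 482 (the class: "symmetrizeable
  hyperbolic or strictly hyperbolic"; "Using the finite speed of propagation for (1)").
* [Taylor1981] M. E. Taylor, *Pseudodifferential Operators* (1981), Ch. IV §3 Def. 3.1–3.2,
  Prop. 3.1; §4 Thm 4.5.
-/

noncomputable section

open Set Filter Matrix Polynomial
open scoped Topology ContDiff

namespace Literature.Barriers.AtomisticToContinuum

open Literature.Analysis.FluidPDE Literature.LinearAlgebra.Matrix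

/-! ### `2 × 2` algebra over a commutative ring -/

section TwoByTwo

/-- A `2 × 2` matrix with equal off-diagonal entries is symmetric. [folklore] -/
theorem isSymm_of_apply_one_zero_eq {R : Type*} {M : Matrix (Fin 2) (Fin 2) R} (h : M 1 0 = M 0 1) :
    M.IsSymm := by
  refine Matrix.IsSymm.ext fun i j => ?_
  fin_cases i <;> fin_cases j
  · rfl
  · exact h
  · exact h.symm
  · rfl

variable {R : Type*} [CommRing R]

/-- The discriminant `(P₀₀ - P₁₁)² + 4 P₀₁P₁₀ = (tr P)² - 4 det P` of a `2 × 2` matrix: its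
characteristic polynomial has two distinct real roots iff it is positive. [folklore] -/
def disc₂ (P : Matrix (Fin 2) (Fin 2) R) : R :=
  (P 0 0 - P 1 1) ^ 2 + 4 * (P 0 1 * P 1 0)

/-- The polar form of `disc₂` (half the mixed term of `disc₂ (x • P + y • Q)`). [folklore] -/
def discPolar₂ (P Q : Matrix (Fin 2) (Fin 2) R) : R :=
  (P 0 0 - P 1 1) * (Q 0 0 - Q 1 1) + 2 * (P 0 1 * Q 1 0 + Q 0 1 * P 1 0)

/-- `disc₂ P = (tr P)² - 4 det P`. [folklore] -/
theorem disc₂_eq_trace_sq_sub_det (P : Matrix (Fin 2) (Fin 2) R) :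
    disc₂ P = P.trace ^ 2 - 4 * P.det := by
  rw [disc₂, trace_fin_two, det_fin_two]
  ring

/-- `disc₂` along a pencil is the binary quadratic form
`disc₂ P · x² + 2 · discPolar₂ P Q · xy + disc₂ Q · y²`. [folklore] -/
theorem disc₂_add_smul (P Q : Matrix (Fin 2) (Fin 2) R) (x y : R) :
    disc₂ (x • P + y • Q) = disc₂ P * x ^ 2 + 2 * discPolar₂ P Q * (x * y) + disc₂ Q * y ^ 2 := by
  simp only [disc₂, discPolar₂, Matrix.add_apply, Matrix.smul_apply, smul_eq_mul]
  ring

/-- **The common symmetrizer of a pair of `2 × 2` matrices.** With `a = P₀₀ - P₁₁`,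
`b = P₀₁`, `c = P₁₀` (and primes for `Q`), the symmetric matrix `S = [[p, r], [r, s]]` with
`(p, r, s) = (b, -a, -c) × (b', -a', -c')`, i.e. `p = ac' - a'c`, `r = bc' - b'c`,
`s = ab' - a'b`: it satisfies the two linear conditions `pb - ra - sc = 0`, `pb' - ra' - sc' = 0`
which say exactly that `SP` and `SQ` are symmetric. [folklore] -/
def pairSymmetrizer₂ (P Q : Matrix (Fin 2) (Fin 2) R) : Matrix (Fin 2) (Fin 2) R :=
  !![(P 0 0 - P 1 1) * Q 1 0 - (Q 0 0 - Q 1 1) * P 1 0, P 0 1 * Q 1 0 - Q 0 1 * P 1 0;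
     P 0 1 * Q 1 0 - Q 0 1 * P 1 0, (P 0 0 - P 1 1) * Q 0 1 - (Q 0 0 - Q 1 1) * P 0 1]

/-- `pairSymmetrizer₂ P Q` is symmetric. [folklore] -/
theorem isSymm_pairSymmetrizer₂ (P Q : Matrix (Fin 2) (Fin 2) R) : (pairSymmetrizer₂ P Q).IsSymm :=
  isSymm_of_apply_one_zero_eq (by simp [pairSymmetrizer₂])

/-- `pairSymmetrizer₂ P Q · P` is symmetric. [folklore] -/
theorem isSymm_pairSymmetrizer₂_mul_left (P Q : Matrix (Fin 2) (Fin 2) R) :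
    (pairSymmetrizer₂ P Q * P).IsSymm := by
  refine isSymm_of_apply_one_zero_eq ?_
  simp only [Matrix.mul_apply, Fin.sum_univ_two, pairSymmetrizer₂, Matrix.of_apply,
    Matrix.cons_val', Matrix.cons_val_zero, Matrix.cons_val_one, Matrix.empty_val',
    Matrix.cons_val_fin_one]
  ring

/-- `pairSymmetrizer₂ P Q · Q` is symmetric. [folklore] -/
theorem isSymm_pairSymmetrizer₂_mul_right (P Q : Matrix (Fin 2) (Fin 2) R) :
    (pairSymmetrizer₂ P Q * Q).IsSymm := by
  refine isSymm_of_apply_one_zero_eq ?_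
  simp only [Matrix.mul_apply, Fin.sum_univ_two, pairSymmetrizer₂, Matrix.of_apply,
    Matrix.cons_val', Matrix.cons_val_zero, Matrix.cons_val_one, Matrix.empty_val',
    Matrix.cons_val_fin_one]
  ring

/-- **The determinant identity**: `4 det S = disc₂ P · disc₂ Q - (discPolar₂ P Q)²`, the
discriminant of the binary form `disc₂ (x • P + y • Q)`. [folklore] -/
theorem four_mul_det_pairSymmetrizer₂ (P Q : Matrix (Fin 2) (Fin 2) R) :
    4 * (pairSymmetrizer₂ P Q).det = disc₂ P * disc₂ Q - discPolar₂ P Q ^ 2 := by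
  simp only [det_fin_two, pairSymmetrizer₂, disc₂, discPolar₂, Matrix.of_apply, Matrix.cons_val',
    Matrix.cons_val_zero, Matrix.cons_val_one, Matrix.empty_val', Matrix.cons_val_fin_one]
  ring

/-- Functoriality: `pairSymmetrizer₂` commutes with ring homomorphisms (it is a polynomial in
the entries). [folklore] -/
theorem pairSymmetrizer₂_map {S : Type*} [CommRing S] (f : R →+* S) (P Q : Matrix (Fin 2) (Fin 2) R) :
    pairSymmetrizer₂ (P.map f) (Q.map f) = (pairSymmetrizer₂ P Q).map f := by
  ext i j
  fin_cases i <;> fin_cases j <;> simp [pairSymmetrizer₂, map_sub, map_mul]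

/-- **The symmetrizer of a triple** `(A₀, A₁, A₂)` of `2 × 2` matrices:
`T = det A₀ · S(adj A₀ · A₁, adj A₀ · A₂) · adj A₀` (denominator-free form of
`S(A₀⁻¹A₁, A₀⁻¹A₂) A₀⁻¹`). [folklore] -/
def tripleSymmetrizer₂ (A₀ A₁ A₂ : Matrix (Fin 2) (Fin 2) R) : Matrix (Fin 2) (Fin 2) R :=
  A₀.det • (pairSymmetrizer₂ (A₀.adjugate * A₁) (A₀.adjugate * A₂) * A₀.adjugate)

/-- `T · A₀ = det(A₀)² · S`. [folklore] -/
theorem tripleSymmetrizer₂_mul_A₀ (A₀ A₁ A₂ : Matrix (Fin 2) (Fin 2) R) :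
    tripleSymmetrizer₂ A₀ A₁ A₂ * A₀ =
      (A₀.det ^ 2) • pairSymmetrizer₂ (A₀.adjugate * A₁) (A₀.adjugate * A₂) := by
  rw [tripleSymmetrizer₂, smul_mul_assoc, Matrix.mul_assoc, adjugate_mul, mul_smul_comm, mul_one,
    smul_smul, sq]

/-- `T · A₁ = det A₀ · (S · (adj A₀ · A₁))`. [folklore] -/
theorem tripleSymmetrizer₂_mul_A₁ (A₀ A₁ A₂ : Matrix (Fin 2) (Fin 2) R) :
    tripleSymmetrizer₂ A₀ A₁ A₂ * A₁ =
      A₀.det • (pairSymmetrizer₂ (A₀.adjugate * A₁) (A₀.adjugate * A₂) * (A₀.adjugate * A₁)) := by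
  rw [tripleSymmetrizer₂, smul_mul_assoc, Matrix.mul_assoc]

/-- `T · A₂ = det A₀ · (S · (adj A₀ · A₂))`. [folklore] -/
theorem tripleSymmetrizer₂_mul_A₂ (A₀ A₁ A₂ : Matrix (Fin 2) (Fin 2) R) :
    tripleSymmetrizer₂ A₀ A₁ A₂ * A₂ =
      A₀.det • (pairSymmetrizer₂ (A₀.adjugate * A₁) (A₀.adjugate * A₂) * (A₀.adjugate * A₂)) := by
  rw [tripleSymmetrizer₂, smul_mul_assoc, Matrix.mul_assoc]

/-- `T · A₁` is symmetric. [folklore] -/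
theorem isSymm_tripleSymmetrizer₂_mul_A₁ (A₀ A₁ A₂ : Matrix (Fin 2) (Fin 2) R) :
    (tripleSymmetrizer₂ A₀ A₁ A₂ * A₁).IsSymm := by
  rw [tripleSymmetrizer₂_mul_A₁]
  exact (isSymm_pairSymmetrizer₂_mul_left _ _).smul _

/-- `T · A₂` is symmetric. [folklore] -/
theorem isSymm_tripleSymmetrizer₂_mul_A₂ (A₀ A₁ A₂ : Matrix (Fin 2) (Fin 2) R) :
    (tripleSymmetrizer₂ A₀ A₁ A₂ * A₂).IsSymm := by
  rw [tripleSymmetrizer₂_mul_A₂]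
  exact (isSymm_pairSymmetrizer₂_mul_right _ _).smul _

/-- Functoriality of the triple symmetrizer. [folklore] -/
theorem tripleSymmetrizer₂_map {S : Type*} [CommRing S] (f : R →+* S)
    (A₀ A₁ A₂ : Matrix (Fin 2) (Fin 2) R) :
    tripleSymmetrizer₂ (A₀.map f) (A₁.map f) (A₂.map f) = (tripleSymmetrizer₂ A₀ A₁ A₂).map f := by
  have hadj : (A₀.map f).adjugate = A₀.adjugate.map f := by
    have h := RingHom.map_adjugate f A₀
    simp only [RingHom.mapMatrix_apply] at h
    exact h.symm
  have hdet : (A₀.map f).det = f A₀.det := by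
    rw [RingHom.map_det, RingHom.mapMatrix_apply]
  rw [tripleSymmetrizer₂, tripleSymmetrizer₂, hadj, hdet, ← Matrix.map_mul, ← Matrix.map_mul,
    pairSymmetrizer₂_map, ← Matrix.map_mul, map_smul_ringHom]

end TwoByTwo

/-! ### Over `ℝ`: discriminants, positivity of the pair symmetrizer, positive definiteness -/

section RealTwoByTwo

/-- A `2 × 2` real matrix whose characteristic polynomial has two distinct real roots has
positive discriminant: `disc₂ P = (μ₀ - μ₁)²`. [folklore] -/
theorem disc₂_pos_of_charpoly_eq_prod {P : Matrix (Fin 2) (Fin 2) ℝ} {μ : Fin 2 → ℝ}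
    (hμ : Function.Injective μ) (hchar : P.charpoly = ∏ i, (X - C (μ i))) : 0 < disc₂ P := by
  have hroot : ∀ i, P.trace * μ i = μ i ^ 2 + P.det := by
    intro i
    have h : P.charpoly.IsRoot (μ i) := by
      rw [hchar, IsRoot.def, eval_prod]
      exact Finset.prod_eq_zero (Finset.mem_univ i) (by simp)
    rw [charpoly_fin_two, IsRoot.def] at h
    simp only [eval_add, eval_sub, eval_pow, eval_X, eval_mul, eval_C] at h
    linarith
  have hne : μ 0 ≠ μ 1 := fun h => absurd (hμ h) (by decide)
  have h0 := hroot 0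
  have h1 := hroot 1
  have htr : P.trace = μ 0 + μ 1 := by
    have hmul : (μ 0 - μ 1) * (P.trace - (μ 0 + μ 1)) = 0 := by linear_combination h0 - h1
    rcases mul_eq_zero.1 hmul with h | h
    · exact absurd (sub_eq_zero.1 h) hne
    · exact sub_eq_zero.1 h
  have hdet : P.det = μ 0 * μ 1 := by linear_combination (-1 : ℝ) * h0 + μ 0 * htr
  rw [disc₂_eq_trace_sq_sub_det, htr, hdet,
    show (μ 0 + μ 1) ^ 2 - 4 * (μ 0 * μ 1) = (μ 0 - μ 1) ^ 2 by ring]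
  exact sq_pos_of_ne_zero (sub_ne_zero.2 hne)

/-- **Positivity of the pair symmetrizer**: if the binary form `disc₂ (x • P + y • Q)` is positive
definite (the pencil `xP + yQ` has simple real spectrum for `(x, y) ≠ 0`), then
`det (pairSymmetrizer₂ P Q) > 0`. [folklore] -/
theorem det_pairSymmetrizer₂_pos {P Q : Matrix (Fin 2) (Fin 2) ℝ}
    (h : ∀ x y : ℝ, (x, y) ≠ (0, 0) → 0 < disc₂ (x • P + y • Q)) : 0 < (pairSymmetrizer₂ P Q).det := by
  have hA : 0 < disc₂ P := by simpa using h 1 0 (by simp)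
  have hkey := h (-discPolar₂ P Q) (disc₂ P) (by simp [hA.ne'])
  rw [disc₂_add_smul, show disc₂ P * (-discPolar₂ P Q) ^ 2 +
      2 * discPolar₂ P Q * (-discPolar₂ P Q * disc₂ P) + disc₂ Q * disc₂ P ^ 2 =
      disc₂ P * (disc₂ P * disc₂ Q - discPolar₂ P Q ^ 2) by ring] at hkey
  have h4 := four_mul_det_pairSymmetrizer₂ P Q
  have hpos : 0 < disc₂ P * disc₂ Q - discPolar₂ P Q ^ 2 := (mul_pos_iff_of_pos_left hA).1 hkey
  linarith

/-- A symmetric `2 × 2` real matrix with positive determinant and positive `(0,0)` entry is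
positive definite (`M₀₀ · xᵀMx = (M₀₀x₀ + M₀₁x₁)² + det M · x₁²`). [folklore] -/
theorem posDef_fin_two_of_det_pos {M : Matrix (Fin 2) (Fin 2) ℝ} (hM : M.IsSymm) (hdet : 0 < M.det)
    (h00 : 0 < M 0 0) : M.PosDef := by
  have h10 : M 1 0 = M 0 1 := by
    have h := congr_fun (congr_fun hM 0) 1
    rwa [transpose_apply] at h
  rw [det_fin_two, h10] at hdet
  refine Matrix.PosDef.of_dotProduct_mulVec_pos ?_ fun x hx => ?_
  · show Mᴴ = M
    rw [conjTranspose_eq_transpose_of_trivial]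
    exact hM
  · have hx' : x 0 ≠ 0 ∨ x 1 ≠ 0 := by
      by_contra hcon
      simp only [not_or, not_not] at hcon
      exact hx (funext fun i => by fin_cases i <;> simp [hcon.1, hcon.2])
    simp only [star_trivial, dotProduct, mulVec, Fin.sum_univ_two, h10]
    have key : M 0 0 * (x 0 * (M 0 0 * x 0 + M 0 1 * x 1) + x 1 * (M 0 1 * x 0 + M 1 1 * x 1)) =
        (M 0 0 * x 0 + M 0 1 * x 1) ^ 2 + (M 0 0 * M 1 1 - M 0 1 * M 0 1) * x 1 ^ 2 := by ring
    have hpos : 0 < (M 0 0 * x 0 + M 0 1 * x 1) ^ 2 + (M 0 0 * M 1 1 - M 0 1 * M 0 1) * x 1 ^ 2 := by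
      by_cases h1 : x 1 = 0
      · have h0 : x 0 ≠ 0 := hx'.resolve_right (not_not.2 h1)
        rw [h1, mul_zero, add_zero, zero_pow two_ne_zero, mul_zero, add_zero]
        exact sq_pos_of_ne_zero (mul_ne_zero h00.ne' h0)
      · have hsq : 0 < x 1 ^ 2 := sq_pos_of_ne_zero h1
        nlinarith [sq_nonneg (M 0 0 * x 0 + M 0 1 * x 1), mul_pos hdet hsq]
    rw [← key] at hpos
    exact (mul_pos_iff_of_pos_left h00).1 hpos

/-- Scaled version: `t • M` is positive definite when `M` is symmetric `2 × 2` with `det M > 0`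
and `t · M₀₀ > 0`. [folklore] -/
theorem posDef_smul_fin_two_of_det_pos {M : Matrix (Fin 2) (Fin 2) ℝ} (hM : M.IsSymm)
    (hdet : 0 < M.det) {t : ℝ} (ht : 0 < t * M 0 0) : (t • M).PosDef := by
  have ht0 : t ≠ 0 := by
    rintro rfl
    simp at ht
  refine posDef_fin_two_of_det_pos (hM.smul t) ?_ (by simpa using ht)
  rw [det_smul, Fintype.card_fin]
  exact mul_pos (by positivity) hdet

end RealTwoByTwo

/-! ### Smooth dependence of the triple symmetrizer -/

section Smooth

variable {E : Type*} [NormedAddCommGroup E] [NormedSpace ℝ E]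

/-- **The triple symmetrizer of smooth `2 × 2` matrix fields has smooth entries** (a polynomial
in the entries; functoriality over the algebra of smooth functions). [folklore] -/
theorem contDiff_tripleSymmetrizer₂_apply {A₀ A₁ A₂ : E → Matrix (Fin 2) (Fin 2) ℝ}
    (h₀ : ∀ i j, ContDiff ℝ ∞ fun u => A₀ u i j) (h₁ : ∀ i j, ContDiff ℝ ∞ fun u => A₁ u i j)
    (h₂ : ∀ i j, ContDiff ℝ ∞ fun u => A₂ u i j) (i j : Fin 2) :
    ContDiff ℝ ∞ fun u => tripleSymmetrizer₂ (A₀ u) (A₁ u) (A₂ u) i j := by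
  set T := tripleSymmetrizer₂ (smoothMatrix A₀ h₀) (smoothMatrix A₁ h₁) (smoothMatrix A₂ h₂)
    with hT
  have key : (fun u => tripleSymmetrizer₂ (A₀ u) (A₁ u) (A₂ u) i j) = fun u => (T i j).1 u := by
    funext u
    have h := tripleSymmetrizer₂_map (smoothEval u) (smoothMatrix A₀ h₀) (smoothMatrix A₁ h₁)
      (smoothMatrix A₂ h₂)
    rw [smoothMatrix_map_smoothEval, smoothMatrix_map_smoothEval, smoothMatrix_map_smoothEval] at h
    rw [h, ← hT, Matrix.map_apply]
    rfl
  rw [key]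
  exact (T i j).2

end Smooth

/-! ### Strictly hyperbolic systems with two unknowns -/

namespace QuasilinearSystem

variable {d : ℕ}

/-- For two unknowns, Rauch's strict hyperbolicity at `u` (with `det A₀(u) ≠ 0`) says that the
discriminant of `adj A₀(u) · Σ ξⱼAⱼ(u)` is positive for every `ξ ≠ 0`. [cite: Rauch1986, p. 482] -/
theorem IsStrictlyHyperbolicAt.disc₂_pos {S : QuasilinearSystem d 2} {u : Fin 2 → ℝ}
    (hdet : (S.A0 u).det ≠ 0) (h : S.IsStrictlyHyperbolicAt u) {ξ : Fin d → ℝ} (hξ : ξ ≠ 0) :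
    0 < disc₂ ((S.A0 u).adjugate * ∑ j, ξ j • S.A j u) := by
  obtain ⟨lam, hinj, hchar⟩ := IsStrictlyHyperbolicAt.charpoly_adjugate_mul_eq_prod hdet h hξ
  exact disc₂_pos_of_charpoly_eq_prod hinj hchar

/-- The pencil `adj A₀ · Σ ξⱼAⱼ` is the linear combination of the `adj A₀ · Aⱼ`. [folklore] -/
theorem adjugate_mul_sum_smul (S : QuasilinearSystem d 2) (u : Fin 2 → ℝ) (ξ : Fin d → ℝ) :
    (S.A0 u).adjugate * ∑ j, ξ j • S.A j u = ∑ j, ξ j • ((S.A0 u).adjugate * S.A j u) := by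
  rw [Finset.mul_sum]
  simp

/-- **No space dimension `d ≥ 3` for two unknowns**: a `2 × 2` system in `d ≥ 3` space variables
is strictly hyperbolic (with `A₀` invertible) at no state — the trace-free parts of the
`adj A₀ · Aⱼ` span a subspace of `sl₂(ℝ)` on which the discriminant, a quadratic form of
signature `(2, 1)`, would be positive definite; concretely some `ξ ≠ 0` makes the pencil
trace-free-diagonal-free with opposite off-diagonal entries, where `disc₂ = -4b² ≤ 0`.
[folklore] -/
theorem not_isStrictlyHyperbolicAt_of_three_le (hd : 3 ≤ d) (S : QuasilinearSystem d 2)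
    {u : Fin 2 → ℝ} (hdet : (S.A0 u).det ≠ 0) : ¬ S.IsStrictlyHyperbolicAt u := by
  intro h
  set P : Fin d → Matrix (Fin 2) (Fin 2) ℝ := fun j => (S.A0 u).adjugate * S.A j u with hP
  -- the two linear conditions `a'(ξ) = 0`, `b(ξ) + c(ξ) = 0` have a common nonzero solution
  set v : Fin d → ℝ × ℝ := fun j => (P j 0 0 - P j 1 1, P j 0 1 + P j 1 0) with hv
  have hlt : Module.finrank ℝ (ℝ × ℝ) < Module.finrank ℝ (Fin d → ℝ) := by
    simp only [Module.finrank_prod, Module.finrank_self, Module.finrank_fin_fun]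
    omega
  have hker := LinearMap.ker_ne_bot_of_finrank_lt (f := Fintype.linearCombination ℝ v) hlt
  obtain ⟨ξ, hξker, hξ0⟩ := (Submodule.ne_bot_iff _).1 hker
  have hfξ : ∑ j, ξ j • v j = 0 := by
    rw [← Fintype.linearCombination_apply]
    exact LinearMap.mem_ker.1 hξker
  have h1 : ∑ j, ξ j * (P j 0 0 - P j 1 1) = 0 := by
    have := congr_arg Prod.fst hfξ
    simpa [Prod.fst_sum, hv] using this
  have h2 : ∑ j, ξ j * (P j 0 1 + P j 1 0) = 0 := by
    have := congr_arg Prod.snd hfξ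
    simpa [Prod.snd_sum, hv] using this
  -- the pencil at `ξ`
  have hpos := h.disc₂_pos hdet hξ0
  rw [adjugate_mul_sum_smul, disc₂] at hpos
  simp only [Matrix.sum_apply, Matrix.smul_apply, smul_eq_mul] at hpos
  have ha : ∑ j, ξ j * P j 0 0 - ∑ j, ξ j * P j 1 1 = 0 := by
    rw [← Finset.sum_sub_distrib]
    simpa [mul_sub] using h1
  have hb : ∑ j, ξ j * P j 1 0 = -∑ j, ξ j * P j 0 1 := by
    rw [eq_neg_iff_add_eq_zero, add_comm, ← Finset.sum_add_distrib]
    simpa [mul_add] using h2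
  rw [ha, hb] at hpos
  nlinarith [sq_nonneg (∑ j, ξ j * P j 0 1)]

/-- **Strictly hyperbolic `2 × 2` systems in two space dimensions are symmetrizable near `ū`**,
with the smooth symmetrizer `Sym(u) = ± det A₀ · S(adj A₀ A₁, adj A₀ A₂) · adj A₀`, `S` the pair
symmetrizer: `Sym A₀ = ± det(A₀)² S` is symmetric positive definite (the sign fixed at `ū`) and
`Sym A₁`, `Sym A₂` are symmetric. [folklore] -/
theorem IsStrictlyHyperbolicNear.isSymmetrizableNear_two_two {S : QuasilinearSystem 2 2}
    {ubar : Fin 2 → ℝ} (h : S.IsStrictlyHyperbolicNear ubar) : S.IsSymmetrizableNear ubar := by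
  obtain ⟨U, hU, hU'⟩ := h
  -- the pair symmetrizer field `Sp`, the triple symmetrizer field `T`, and `q = (T A₀)₀₀`
  set Sp : (Fin 2 → ℝ) → Matrix (Fin 2) (Fin 2) ℝ := fun u =>
    pairSymmetrizer₂ ((S.A0 u).adjugate * S.A 0 u) ((S.A0 u).adjugate * S.A 1 u) with hSp
  set T : (Fin 2 → ℝ) → Matrix (Fin 2) (Fin 2) ℝ := fun u =>
    tripleSymmetrizer₂ (S.A0 u) (S.A 0 u) (S.A 1 u) with hT
  have hTA0 : ∀ u, T u * S.A0 u = ((S.A0 u).det ^ 2) • Sp u := fun u =>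
    tripleSymmetrizer₂_mul_A₀ _ _ _
  set q : (Fin 2 → ℝ) → ℝ := fun u => (T u * S.A0 u) 0 0 with hq
  have hq_eq : ∀ u, q u = (S.A0 u).det ^ 2 * Sp u 0 0 := fun u => by
    simp only [hq, hTA0, Matrix.smul_apply, smul_eq_mul]
  -- `det Sp > 0` on `U`
  have hdetS : ∀ u ∈ U, 0 < (Sp u).det := by
    intro u hu
    obtain ⟨hdet, hsh⟩ := hU' u hu
    refine det_pairSymmetrizer₂_pos fun x y hxy => ?_
    have hξ : (![x, y] : Fin 2 → ℝ) ≠ 0 := by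
      intro h0
      apply hxy
      have h0' := congr_fun h0 0
      have h1' := congr_fun h0 1
      simp only [Matrix.cons_val_zero, Matrix.cons_val_one, Pi.zero_apply] at h0' h1'
      rw [h0', h1']
    have hpos := hsh.disc₂_pos hdet hξ
    rw [adjugate_mul_sum_smul, Fin.sum_univ_two] at hpos
    simpa using hpos
  -- the sign of `q` at `ū`
  have hubar : ubar ∈ U := mem_of_mem_nhds hU
  have hq0 : q ubar ≠ 0 := by
    rw [hq_eq]
    refine mul_ne_zero (pow_ne_zero _ (hU' ubar hubar).1) fun h0 => ?_
    have hd := hdetS ubar hubar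
    have h10 : Sp ubar 1 0 = Sp ubar 0 1 := by simp [hSp, pairSymmetrizer₂]
    rw [det_fin_two, h0, h10] at hd
    nlinarith [sq_nonneg (Sp ubar 0 1)]
  set σ : ℝ := if 0 < q ubar then 1 else -1 with hσ
  have hσq : 0 < σ * q ubar := by
    rcases lt_or_gt_of_ne hq0 with hlt | hgt
    · rw [hσ, if_neg (not_lt.2 hlt.le)]
      linarith
    · rw [hσ, if_pos hgt]
      linarith
  -- `q` is continuous (smooth entries)
  have hTsmooth : ∀ i j, ContDiff ℝ ∞ fun u => T u i j := fun i j =>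
    contDiff_tripleSymmetrizer₂_apply S.contDiff_A0 (S.contDiff_A 0) (S.contDiff_A 1) i j
  have hqcont : Continuous fun u => σ * q u := by
    refine continuous_const.mul ?_
    simp only [hq, Matrix.mul_apply, Fin.sum_univ_two]
    exact ((hTsmooth 0 0).continuous.mul (S.contDiff_A0 0 0).continuous).add
      ((hTsmooth 0 1).continuous.mul (S.contDiff_A0 1 0).continuous)
  -- the neighbourhood where the sign is right
  have hV : U ∩ {u | 0 < σ * q u} ∈ 𝓝 ubar :=
    inter_mem hU ((isOpen_lt continuous_const hqcont).mem_nhds hσq)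
  refine ⟨U ∩ {u | 0 < σ * q u}, hV, fun u => σ • T u, fun i i' => ?_, fun u hu => ⟨?_, fun j => ?_⟩⟩
  · exact (hTsmooth i i').const_smul σ
  · obtain ⟨huU, huq⟩ := hu
    have hmul : σ • T u * S.A0 u = (σ * (S.A0 u).det ^ 2) • Sp u := by
      rw [smul_mul_assoc, hTA0, smul_smul]
    rw [hmul]
    refine posDef_smul_fin_two_of_det_pos (isSymm_pairSymmetrizer₂ _ _) (hdetS u huU) ?_
    have hq' : 0 < σ * q u := huq
    rw [hq_eq] at hq'
    linarith [hq']
  · obtain ⟨huU, -⟩ := hu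
    rw [smul_mul_assoc]
    fin_cases j
    · exact (isSymm_tripleSymmetrizer₂_mul_A₁ _ _ _).smul _
    · exact (isSymm_tripleSymmetrizer₂_mul_A₂ _ _ _).smul _

end QuasilinearSystem

open QuasilinearSystem

/-! ### Finite speed of propagation for `k ≤ 2`, and what remains of the named fact -/

/-- **Finite speed of propagation for strictly hyperbolic systems with two unknowns**, in every
space dimension: `d ≤ 1` is the one-dimensional case, `d = 2` is symmetrizable
(`isSymmetrizableNear_two_two`), and `d ≥ 3` is vacuous
(`not_isStrictlyHyperbolicAt_of_three_le`). [cite: Rauch1986, Proof of Theorem p. 482] -/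
theorem hasPropagationSpeed_of_isStrictlyHyperbolicNear_of_k_eq_two {d : ℕ}
    (S : QuasilinearSystem d 2) {ubar : Fin 2 → ℝ} (hB : S.B ubar = 0)
    (h : S.IsStrictlyHyperbolicNear ubar) : ∃ c : ℝ, 0 ≤ c ∧ S.HasPropagationSpeed ubar c := by
  rcases Nat.lt_or_ge d 2 with hd | hd
  · exact exists_hasPropagationSpeed_of_isRauchClass_of_d_le_one (by omega) S ubar
      (IsRauchClass.of_isStrictlyHyperbolicNear hB h)
  rcases hd.eq_or_lt with rfl | hd3
  · exact Rauch1986_finitePropagationSpeed_symmetrizable_holds S ubar hB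
      h.isSymmetrizableNear_two_two
  · obtain ⟨U, hU, hU'⟩ := h
    obtain ⟨hdet, hsh⟩ := hU' ubar (mem_of_mem_nhds hU)
    exact absurd hsh (not_isStrictlyHyperbolicAt_of_three_le (by omega) S hdet)

/-- **Rauch's fact `Rauch1986_finitePropagationSpeed` holds unconditionally for `k ≤ 2`** (at
most two unknowns, every space dimension). [cite: Rauch1986, Proof of Theorem p. 482] -/
theorem exists_hasPropagationSpeed_of_isRauchClass_of_le_two {d k : ℕ} (hk : k ≤ 2)
    (S : QuasilinearSystem d k) (ubar : Fin k → ℝ) (hS : S.IsRauchClass ubar) :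
    ∃ c : ℝ, 0 ≤ c ∧ S.HasPropagationSpeed ubar c := by
  rcases hk.lt_or_eq with hk1 | rfl
  · exact exists_hasPropagationSpeed_of_isRauchClass_of_le_one (by omega) S ubar hS
  · rcases hS.symmetrizableNear_or with h | h
    · exact Rauch1986_finitePropagationSpeed_symmetrizable_holds S ubar hS.B_eq_zero h
    · exact hasPropagationSpeed_of_isStrictlyHyperbolicNear_of_k_eq_two S hS.B_eq_zero h

/-- **What remains of `Rauch1986_finitePropagationSpeed`**: the named fact follows from finite
speed of propagation for strictly hyperbolic systems with `d ≥ 2` space variables and `k ≥ 3`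
unknowns (where strictly hyperbolic systems need not admit a matrix symmetrizer and the printed
proofs use symbolic symmetrizers [Taylor1981, Ch. IV §3 Prop. 3.1, §4 Thm 4.5]); every other
case is proved. [cite: Rauch1986, Proof of Theorem p. 482] -/
theorem Rauch1986_finitePropagationSpeed_of_three_le
    (h : ∀ ⦃d k : ℕ⦄, 2 ≤ d → 3 ≤ k → ∀ (S : QuasilinearSystem d k) (ubar : Fin k → ℝ),
      S.B ubar = 0 → S.IsStrictlyHyperbolicNear ubar → ∃ c : ℝ, 0 ≤ c ∧ S.HasPropagationSpeed ubar c) :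
    Rauch1986_finitePropagationSpeed := by
  intro d k S ubar hS
  by_cases hk : k ≤ 2
  · exact exists_hasPropagationSpeed_of_isRauchClass_of_le_two hk S ubar hS
  rcases hS.symmetrizableNear_or with h' | h'
  · exact Rauch1986_finitePropagationSpeed_symmetrizable_holds S ubar hS.B_eq_zero h'
  by_cases hd : 2 ≤ d
  · exact h hd (by omega) S ubar hS.B_eq_zero h'
  · exact exists_hasPropagationSpeed_of_isRauchClass_of_d_le_one (by omega) S ubar hS

end Literature.Barriers.AtomisticToContinuum

end
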